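import Literature.AlgebraicGeometry.Resolution.ArtinApproximation
import Literature.AlgebraicGeometry.Resolution.ArtinApproximationAffine
import Literature.AlgebraicGeometry.Resolution.ArtinApproximationAffinePoint
import Literature.AlgebraicGeometry.Resolution.ExcellentRingsProofs
import Literature.AlgebraicGeometry.Resolution.WeakJacobianPolynomial
import Mathlib.AlgebraicGeometry.Morphisms.Etale
import Mathlib.AlgebraicGeometry.Morphisms.FiniteType
import Mathlib.AlgebraicGeometry.ResidueField
import HarnessLib

/-!
# Artin approximation over étale neighbourhoods (Artin 1969, Cor. 2.1): the scheme assembly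

Topic: `Literature/AlgebraicGeometry/Resolution`. The named fact `Artin1969EtaleApproximation`
(`ArtinApproximation.lean`; Artin 1969, Cor. 2.1 for `S` of finite type over a field) is
REDUCED here to three (in fact two) classical named facts, along the printed proof of Stacks,
Tag 07QZ:

* `Popescu1986_generalNeronDesingularization` (Popescu 1986, Thm. 2.5; Stacks 07GC),
* `Stacks07M7_etaleLift` (Stacks 07M7: étale lifting of sections of smooth algebras),
* `Matsumura1987_32_6_cor` (finitely generated algebras over a field are G-rings; in the tree
  further reduced to `Matsumura1987_32_polynomial`, `ExcellentRingsProofs.lean`),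

via the affine form `exists_etale_solution_of_isGRing` (`ArtinApproximationAffine.lean`), resp.
`exists_etale_solution_of_isGRing_of_popescu` (`ArtinApproximationAffinePoint.lean`, which
dispenses with `Stacks07M7_etaleLift`).
The assembly: choose an affine open `U = Spec B ∋ s`; `B` is of finite type over `k`, hence a
G-ring; `𝒪_{S,s}` is a localisation of `B` at the prime `𝔭` of `s`; restrict the equations to
`B`; the affine theorem gives an étale `B → B'`, a prime `𝔭'` over `𝔭` with trivial residue
extension and a solution in `B'` with the congruence at every localisation of `B'` at `𝔭'`; the
étale neighbourhood is `S' = Spec B' → Spec B = U ⊆ S` with the point `𝔭'`, whose stalk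
`𝒪_{S',s'}` is such a localisation, the comparison map being `𝒪_{S,s} ≅ 𝒪_{S,e(s')} → 𝒪_{S',s'}`.

* `Artin1969EtaleApproximation.of_affine` — the scheme assembly (PROVED): the affine statement
  for G-rings (the common conclusion of `exists_etale_solution_of_isGRing` and
  `exists_etale_solution_of_isGRing_of_popescu`) and `Matsumura1987_32_6_cor` imply
  `Artin1969EtaleApproximation`.
* `Artin1969EtaleApproximation.of_popescu` — the reduction to the three named facts (PROVED).
* `Artin1969EtaleApproximation.of_generalNeronDesingularization` — the reduction to TWO named
  facts, `Popescu1986_generalNeronDesingularization` and `Matsumura1987_32_6_cor` (PROVED): the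
  étale lifting lemma Stacks 07M7 is needed only at the point `𝔭`, where it is the proved
  theorem `exists_etale_factorisation_of_smooth` (`SmoothPointEtaleFactorisation.lean`,
  `ArtinApproximationAffinePoint.lean`).
* `Artin1969EtaleApproximation.of_popescu_of_mizutani` — the reduction to the two named LEAVES
  currently open in the tree (PROVED): Popescu's theorem and Mizutani's theorem
  `Matsumura1987_32_6` (Matsumura, Thm. 32.6: a regular ring with (WJ) in all its polynomial
  rings is a G-ring), the rest of Matsumura's Corollary being discharged in the tree
  (`Matsumura1987_32_quotient_holds`, `Matsumura1987_30_WJ_polynomial_holds`).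

[cite: Artin1969, Cor. 2.1, p. 27]; [cite: StacksProject, Tag 07QZ]
-/

noncomputable section

open CategoryTheory AlgebraicGeometry TopologicalSpace IsLocalRing Opposite

universe u

namespace Literature.AlgebraicGeometry.Resolution

/-! ## Two computations on `Spec B' → Spec Γ(S, U) → S` -/

/-- For an affine open `U ⊆ X` and `φ : Γ(X, U) → R`, the map on sections
`Γ(X, U) → Γ(Spec R, ⊤)` induced by `Spec R → Spec Γ(X, U) → X` is `φ` followed by the
canonical identification `R ≅ Γ(Spec R, ⊤)`. [folklore] -/
theorem appLE_SpecMap_comp_fromSpec {X : Scheme.{u}} {U : X.Opens} (hU : IsAffineOpen U)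
    {R : CommRingCat.{u}} (φ : Γ(X, U) ⟶ R) (h : ⊤ ≤ (Spec.map φ ≫ hU.fromSpec) ⁻¹ᵁ U) :
    (Spec.map φ ≫ hU.fromSpec).appLE U ⊤ h = φ ≫ (Scheme.ΓSpecIso R).inv := by
  have h₁ : (⊤ : (Spec Γ(X, U)).Opens) ≤ hU.fromSpec ⁻¹ᵁ U := by
    rw [hU.fromSpec_preimage_self]
  have h₂ : (⊤ : (Spec R).Opens) ≤ Spec.map φ ⁻¹ᵁ ⊤ := le_rfl
  rw [← Scheme.Hom.appLE_comp_appLE (Spec.map φ) hU.fromSpec U ⊤ ⊤ h₁ h₂]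
  have e₁ : hU.fromSpec.appLE U ⊤ h₁ = (Scheme.ΓSpecIso Γ(X, U)).inv := by
    rw [Scheme.Hom.appLE, hU.fromSpec_app_self, Category.assoc, ← Functor.map_comp]
    have : (eqToHom hU.fromSpec_preimage_self).op ≫ (homOfLE h₁).op =
        𝟙 (op (⊤ : (Spec Γ(X, U)).Opens)) := Subsingleton.elim _ _
    rw [this, CategoryTheory.Functor.map_id, Category.comp_id]
  have e₂ : (Spec.map φ).appLE ⊤ ⊤ h₂ = (Spec.map φ).appTop := Scheme.Hom.appLE_eq_app _
  rw [e₁, e₂, ← Scheme.ΓSpecIso_inv_naturality]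

/-- Germs commute with `appLE`: for `x ∈ V ⊆ f⁻¹(U)`, the germ at `x` of `f.appLE U V _ (b)`
is the image under `f.stalkMap x` of the germ of `b` at `f x`. [folklore] -/
theorem germ_appLE_eq_stalkMap_germ {X Y : Scheme.{u}} (f : X ⟶ Y) (U : Y.Opens) (V : X.Opens)
    (x : X) (hxV : x ∈ V) (h : V ≤ f ⁻¹ᵁ U) (b : Γ(Y, U)) :
    (X.presheaf.germ V x hxV).hom (f.appLE U V h b) =
      (f.stalkMap x).hom ((Y.presheaf.germ U (f x) (h hxV)).hom b) := by
  have e : f.appLE U V h ≫ X.presheaf.germ V x hxV =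
      Y.presheaf.germ U (f x) (h hxV) ≫ f.stalkMap x := by
    rw [Scheme.Hom.appLE, Category.assoc, X.presheaf.germ_res (homOfLE h) x hxV,
      Scheme.Hom.germ_stalkMap]
  have := congrArg (fun g => g.hom b) e
  simpa only [CommRingCat.hom_comp, RingHom.coe_comp, Function.comp_apply] using this

/-! ## The reduction -/

/-- **Artin 1969, Cor. 2.1, from its affine form and the G-ring property of finitely generated
algebras over a field** (the scheme assembly). Suppose that for every G-ring `B`, prime `𝔭`,
localisation `R` of `B` at `𝔭`, finite system `F = 0` over `B` with a solution `ȳ` in `R^` and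
`N ≥ 0` there are an étale `B → B'`, a prime `𝔭'` over `𝔭` and a solution `y` in `B'` with
trivial residue extension and `y ≡ ȳ (mod 𝔪'^N)` at every localisation of `B'` at `𝔭'` (the
conclusion of `exists_etale_solution_of_isGRing`, Stacks 07QZ). Then, granted
`Matsumura1987_32_6_cor`, `Artin1969EtaleApproximation` holds: choose an affine open
`U = Spec B ∋ s` (`B` of finite type over `k`, a G-ring; `𝒪_{S,s}` a localisation of `B` at the
prime of `s`), restrict the equations to `B`, and take the étale neighbourhood
`Spec B' → Spec B ⊆ S` with the point `𝔭'`. [cite: Artin1969, Cor. 2.1, p. 27];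
[cite: StacksProject, Tag 07QZ] -/
theorem Artin1969EtaleApproximation.of_affine
    (hA : ∀ (B : Type u) [CommRing B] (p : Ideal B) [p.IsPrime] (R : Type u) [CommRing R]
      [IsLocalRing R] [Algebra B R] [IsLocalization.AtPrime R p], IsGRing B →
      ∀ (ι κ : Type) [Finite ι] [Finite κ] (F : κ → MvPolynomial ι B)
        (ybar : ι → AdicCompletion (maximalIdeal R) R),
        (∀ j, MvPolynomial.aeval ybar (F j) = 0) → ∀ (N : ℕ),
        ∃ (B' : Type u) (_ : CommRing B') (_ : Algebra B B') (p' : Ideal B') (_ : p'.IsPrime)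
          (y : ι → B'),
          Algebra.Etale B B' ∧ p'.comap (algebraMap B B') = p ∧
          (∀ j, MvPolynomial.aeval y (F j) = 0) ∧
          ∀ (R' : Type u) [CommRing R'] [IsLocalRing R'] [Algebra B' R']
            [IsLocalization.AtPrime R' p'] (φ : R →+* R'),
            φ.comp (algebraMap B R) = (algebraMap B' R').comp (algebraMap B B') →
            (∀ x : R', ∃ r : R, x - φ r ∈ maximalIdeal R') ∧
            ∀ (i : ι) (a : R),
              AdicCompletion.evalₐ (maximalIdeal R) N (ybar i) = Ideal.Quotient.mk _ a →
                algebraMap B' R' (y i) - φ a ∈ maximalIdeal R' ^ N)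
    (hG : Matsumura1987_32_6_cor.{u}) : Artin1969EtaleApproximation.{u} := by
  intro k _ S f hft hqc s ι κ _ _ F ybar c hF
  classical
  -- an affine open neighbourhood `U = Spec B` of `s`; `B` is of finite type over `k`, a G-ring
  obtain ⟨U, hU, hsU, -⟩ := exists_isAffineOpen_mem_and_subset (X := S) (x := s) (U := ⊤) trivial
  have hle : U ≤ f ⁻¹ᵁ (⊤ : (Spec (CommRingCat.of k)).Opens) := le_top
  have hfU : RingHom.FiniteType (f.appLE ⊤ U hle).hom :=
    HasRingHomProperty.appLE (P := @LocallyOfFiniteType) f hft ⟨⊤, isAffineOpen_top _⟩ ⟨U, hU⟩ hle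
  let φk : k →+* Γ(S, U) :=
    (f.appLE ⊤ U hle).hom.comp (Scheme.ΓSpecIso (CommRingCat.of k)).inv.hom
  letI : Algebra k Γ(S, U) := φk.toAlgebra
  have hBft : Algebra.FiniteType k Γ(S, U) := by
    rw [← RingHom.finiteType_algebraMap, RingHom.algebraMap_toAlgebra]
    refine hfU.comp (RingHom.FiniteType.of_surjective _ fun x => ?_)
    exact ⟨(Scheme.ΓSpecIso (CommRingCat.of k)).hom.hom x, by
      change ((Scheme.ΓSpecIso (CommRingCat.of k)).hom ≫ (Scheme.ΓSpecIso _).inv).hom x = x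
      rw [Iso.hom_inv_id]
      rfl⟩
  have hGB : IsGRing Γ(S, U) := hG k Γ(S, U) hBft
  haveI : IsNoetherianRing Γ(S, U) := hGB.1
  -- the stalk `𝒪_{S,s}` is the localisation of `B` at the prime `𝔭` of `s`
  let p : PrimeSpectrum Γ(S, U) := hU.primeIdealOf ⟨s, hsU⟩
  letI algBR : Algebra Γ(S, U) (S.presheaf.stalk s) := S.presheaf.algebra_section_stalk ⟨s, hsU⟩
  haveI : IsLocalization.AtPrime (S.presheaf.stalk s) p.asIdeal := hU.isLocalization_stalk ⟨s, hsU⟩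
  -- the equations, restricted to `U`
  let res : Γ(S, ⊤) →+* Γ(S, U) := (S.presheaf.map (homOfLE le_top).op).hom
  let FU : κ → MvPolynomial ι Γ(S, U) := fun j => MvPolynomial.map res (F j)
  have hres : ∀ x : Γ(S, ⊤), algebraMap Γ(S, U) (S.presheaf.stalk s) (res x) =
      (S.presheaf.germ ⊤ s trivial).hom x := fun x =>
    TopCat.Presheaf.germ_res_apply S.presheaf (homOfLE le_top) s hsU x
  have hFU : ∀ j, MvPolynomial.aeval ybar (FU j) = 0 := fun j => by
    rw [MvPolynomial.aeval_def, MvPolynomial.eval₂_map, ← hF j]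
    congr 1
    ext x
    change algebraMap (S.presheaf.stalk s) _ (algebraMap Γ(S, U) (S.presheaf.stalk s) (res x)) = _
    rw [hres x]
    rfl
  -- the affine theorem
  obtain ⟨B', _, _, p', _, y, hEt, hp'B, hyF, hloc'⟩ :=
    hA Γ(S, U) p.asIdeal (S.presheaf.stalk s) hGB ι κ FU ybar hFU c
  -- the étale neighbourhood `S' = Spec B' → Spec B = U ⊆ S` and its point `s' = 𝔭'`
  let φ' : Γ(S, U) ⟶ CommRingCat.of B' := CommRingCat.ofHom (algebraMap Γ(S, U) B')
  let S' : Scheme.{u} := Spec (CommRingCat.of B')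
  let e : S' ⟶ S := Spec.map φ' ≫ hU.fromSpec
  let s' : S' := (⟨p', ‹_›⟩ : PrimeSpectrum B')
  have hs : e s' = s := by
    change hU.fromSpec (Spec.map φ' s') = s
    rw [Spec.map_apply]
    have : PrimeSpectrum.comap φ'.hom s' = p := PrimeSpectrum.ext hp'B
    rw [this]
    exact hU.fromSpec_primeIdealOf ⟨s, hsU⟩
  haveI : Etale (Spec.map φ') := by
    rw [HasRingHomProperty.Spec_iff (P := @Etale)]
    change (algebraMap Γ(S, U) B').Etale
    rw [RingHom.etale_algebraMap]
    exact hEt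
  haveI : Etale e := inferInstance
  -- the stalk `𝒪_{S',s'} = B'_{𝔭'}` and the comparison map `φ : 𝒪_{S,s} → 𝒪_{S',s'}`
  letI algB'R' : Algebra B' (S'.presheaf.stalk s') := StructureSheaf.stalkAlgebra (R := B') s'
  haveI : IsLocalization.AtPrime (S'.presheaf.stalk s') p' :=
    StructureSheaf.IsLocalization.to_stalk B' s'
  let φ : S.presheaf.stalk s →+* S'.presheaf.stalk s' :=
    (e.stalkMap s').hom.comp (S.presheaf.stalkCongr (.of_eq hs.symm)).hom.hom
  have htop : (⊤ : S'.Opens) ≤ e ⁻¹ᵁ U := fun x _ => by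
    change e x ∈ U
    have hx : e x ∈ Set.range hU.fromSpec := ⟨Spec.map φ' x, rfl⟩
    rw [hU.range_fromSpec] at hx
    exact hx
  have hφ : φ.comp (algebraMap Γ(S, U) (S.presheaf.stalk s)) =
      (algebraMap B' (S'.presheaf.stalk s')).comp (algebraMap Γ(S, U) B') := by
    ext b
    have h1 : (S.presheaf.stalkCongr (.of_eq hs.symm)).hom.hom
        ((S.presheaf.germ U s hsU).hom b) = (S.presheaf.germ U (e s') (hs ▸ hsU)).hom b :=
      TopCat.Presheaf.germ_stalkSpecializes_apply S.presheaf hsU (Inseparable.of_eq hs.symm).ge b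
    have h2 : (e.stalkMap s').hom ((S.presheaf.germ U (e s') (hs ▸ hsU)).hom b) =
        (S'.presheaf.germ ⊤ s' trivial).hom (e.appLE U ⊤ htop b) :=
      (germ_appLE_eq_stalkMap_germ e U ⊤ s' trivial htop b).symm
    have h3 : (e.appLE U ⊤ htop).hom b =
        (Scheme.ΓSpecIso (.of B')).inv.hom (algebraMap Γ(S, U) B' b) := by
      have := congrArg (fun g => g.hom b) (appLE_SpecMap_comp_fromSpec hU φ' htop)
      simp only [CommRingCat.hom_comp, RingHom.coe_comp, Function.comp_apply] at this
      exact this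
    have h4 : (S'.presheaf.germ ⊤ s' trivial).hom
        ((Scheme.ΓSpecIso (.of B')).inv.hom (algebraMap Γ(S, U) B' b)) =
        algebraMap B' (S'.presheaf.stalk s') (algebraMap Γ(S, U) B' b) :=
      StructureSheaf.algebraMap_germ_apply (R := B') ⊤ s' trivial _
    change (e.stalkMap s').hom ((S.presheaf.stalkCongr (.of_eq hs.symm)).hom.hom
      ((S.presheaf.germ U s hsU).hom b)) = algebraMap B' (S'.presheaf.stalk s') (algebraMap Γ(S, U) B' b)
    rw [h1, h2]
    change (S'.presheaf.germ ⊤ s' trivial).hom ((e.appLE U ⊤ htop).hom b) = _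
    rw [h3, h4]
  obtain ⟨hresid, hcong⟩ := hloc' (S'.presheaf.stalk s') φ hφ
  -- the solution over `S'`
  let y' : ι → Γ(S', ⊤) := fun i => (Scheme.ΓSpecIso (.of B')).inv.hom (y i)
  have hy' : ∀ i, (S'.presheaf.germ ⊤ s' trivial).hom (y' i) =
      algebraMap B' (S'.presheaf.stalk s') (y i) := fun i =>
    StructureSheaf.algebraMap_germ_apply (R := B') ⊤ s' trivial (y i)
  have happ : ∀ x : Γ(S, ⊤), e.appTop.hom x = (e.appLE U ⊤ htop).hom (res x) := fun x => by
    have := congrArg (fun g => g.hom x)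
      (Scheme.Hom.map_appLE e htop (homOfLE (le_top : U ≤ ⊤)).op)
    simp only [CommRingCat.hom_comp, RingHom.coe_comp, Function.comp_apply] at this
    change _ = (e.appLE U ⊤ htop).hom ((S.presheaf.map (homOfLE (le_top : U ≤ ⊤)).op).hom x)
    rw [this]
    change (e.app ⊤).hom x = _
    rw [Scheme.Hom.app_eq_appLE]
    rfl
  have happ' : e.appTop.hom = ((Scheme.ΓSpecIso (.of B')).inv.hom.comp (algebraMap Γ(S, U) B')).comp
      res := by
    ext x
    rw [happ x]
    have := congrArg (fun g => g.hom (res x)) (appLE_SpecMap_comp_fromSpec hU φ' htop)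
    simp only [CommRingCat.hom_comp, RingHom.coe_comp, Function.comp_apply] at this
    exact this
  refine ⟨S', e, s', hs, y', inferInstance, ?_, ?_, ?_⟩
  · -- the residue field extension `κ(s) → κ(s')` is trivial
    intro r
    obtain ⟨x, rfl⟩ := S'.residue_surjective s' r
    obtain ⟨a, ha⟩ := hresid x
    refine ⟨S.residue (e s') ((S.presheaf.stalkCongr (.of_eq hs.symm)).hom.hom a), ?_⟩
    change (S.residue (e s') ≫ e.residueFieldMap s') _ = _
    rw [Scheme.residue_residueFieldMap]
    change IsLocalRing.residue _ (φ a) = IsLocalRing.residue _ x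
    exact (Ideal.Quotient.eq.mpr ha).symm
  · -- the equations hold over `S'`
    intro j
    have h := congrArg (Scheme.ΓSpecIso (.of B')).inv.hom (hyF j)
    rw [map_zero, MvPolynomial.aeval_def, MvPolynomial.eval₂_map, MvPolynomial.eval₂_comp_left] at h
    rw [happ']
    exact h
  · -- the congruence modulo `𝔪_{s'}^c`
    intro i a ha
    have := hcong i a ha
    rw [← hy' i] at this
    exact this

/-- **Artin 1969, Cor. 2.1, from Popescu's theorem, Stacks 07M7 and the G-ring property of
finitely generated algebras over a field.** The named fact `Artin1969EtaleApproximation`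
(algebraic approximation over étale neighbourhoods for schemes of finite type over a field)
follows from the named facts `Popescu1986_generalNeronDesingularization`,
`Stacks07M7_etaleLift` and `Matsumura1987_32_6_cor`, by the affine theorem
`exists_etale_solution_of_isGRing` applied to an affine open neighbourhood `Spec B` of `s` and
the localisation `𝒪_{S,s}` of `B`, the étale neighbourhood being `Spec B' → Spec B ⊆ S`.
[cite: Artin1969, Cor. 2.1, p. 27] -/
theorem Artin1969EtaleApproximation.of_popescu
    (hP : Popescu1986_generalNeronDesingularization.{u}) (hL : Stacks07M7_etaleLift.{u})
    (hG : Matsumura1987_32_6_cor.{u}) : Artin1969EtaleApproximation.{u} :=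
  Artin1969EtaleApproximation.of_affine
    (fun B _ p _ R _ _ _ _ hB ι κ _ _ F ybar hF N => by
      haveI : IsNoetherianRing B := hB.1
      exact exists_etale_solution_of_isGRing p R hP hL hB F ybar hF N)
    hG

/-- **Artin 1969, Cor. 2.1, from Popescu's theorem and the G-ring property of finitely
generated algebras over a field** (two named facts; Stacks 07M7 is not needed as a hypothesis,
its pointwise form `exists_etale_factorisation_of_smooth` being proved): the named fact
`Artin1969EtaleApproximation` follows from `Popescu1986_generalNeronDesingularization` and
`Matsumura1987_32_6_cor`, by the affine theorem `exists_etale_solution_of_isGRing_of_popescu`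
and the scheme assembly `Artin1969EtaleApproximation.of_affine`.
[cite: Artin1969, Cor. 2.1, p. 27]; [cite: StacksProject, Tag 07QZ] -/
theorem Artin1969EtaleApproximation.of_generalNeronDesingularization
    (hP : Popescu1986_generalNeronDesingularization.{u}) (hG : Matsumura1987_32_6_cor.{u}) :
    Artin1969EtaleApproximation.{u} :=
  Artin1969EtaleApproximation.of_affine
    (fun B _ p _ R _ _ _ _ hB ι κ _ _ F ybar hF N => by
      haveI : IsNoetherianRing B := hB.1
      exact exists_etale_solution_of_isGRing_of_popescu p R hP hB F ybar hF N)
    hG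

/-- **Artin 1969, Cor. 2.1, from Popescu's theorem and Mizutani's theorem** (the two named
leaves): `Artin1969EtaleApproximation` follows from `Popescu1986_generalNeronDesingularization`
(Stacks 07GC) and `Matsumura1987_32_6` (Matsumura, Thm. 32.6, H. Mizutani), via
`Matsumura1987_32_6_cor_of_32_6'` (with the discharged quotient step
`Matsumura1987_32_quotient_holds` and (WJ) for polynomial rings) and
`Artin1969EtaleApproximation.of_generalNeronDesingularization`.
[cite: Artin1969, Cor. 2.1, p. 27]; [cite: Matsumura1987, Cor. of Thm. 32.6, p. 260] -/
theorem Artin1969EtaleApproximation.of_popescu_of_mizutani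
    (hP : Popescu1986_generalNeronDesingularization.{u}) (h326 : Matsumura1987_32_6.{u}) :
    Artin1969EtaleApproximation.{u} :=
  Artin1969EtaleApproximation.of_generalNeronDesingularization hP
    (Matsumura1987_32_6_cor_of_32_6' Matsumura1987_32_quotient_holds h326)

end Literature.AlgebraicGeometry.Resolution

end
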